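import Summits.BirchSwinnertonDyer.BirchSwinnertonDyer.Theorems.AdditiveBranchIMCTwistFieldBaseChangeBounded
import HarnessLib

/-!
# Crux `GordTwoRankZeroOffCaseOne` (route `AdditiveBranchIMC`, item 19357), lane k1-c2x gen 2: the
# twist-field road in DESCENDED shape — Part 8: the rational «no free lunch» at predicate level —
# (BC-Gord) ⟸ the b2b located gap `ChiBranchRatLowerDvd[Odd]At W p` + Skinner–Urban for the twist models

Sequel of Parts 2/4/6. Cell `bsd-addord`, seat `bsd-addord-k1-c2x`. Route-independent. HONEST FRAMING:
theorems only; every published input is a DISPLAYED named-fact binder — Skinner–Urban 2014 Thm. 3.6.4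
(first display, in `Λ ⊗ ℚ_p`) for the good ordinary twist models `V` (`skinner_urban_main_conjecture`,
clause (2): `char X(V/ℚ_∞) = (g)`, `ι g = p^k·L_p(f,α,T)`, `k ∈ ℤ`; ITS hypotheses (irr) and the
auxiliary multiplicative prime are displayed per twist model as `hrows`); boundedness of `𝓛` is Part 6's
theorem; `GordTwistBaseChangeLower{Even,Odd}At` (this lane) and `ChiBranchRatLowerDvd[Odd]At` (b2b
n1011-p06, row T-N10R) are typed CONJECTURES — here one is DERIVED from the other plus facts, nothing is
asserted about either; nothing is booked; BSD is not proved by any of this.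

* §14 `C_pow_mul_map_eq_of_map_eq_C_zpow_mul` — integer-exponent bookkeeping: `ι g = p^k·L`, `k ∈ ℤ`
  ⟹ `p^{k₋}·ι g = ι(p^{k₊})·L` with `k₊ = k.toNat`, `k₋ = (−k).toNat`.
* §15 **`gordTwistBaseChangeLowerEvenAt_of_skinnerUrban_of_ratLowerDvd`** (+ odd): on the rows whose
  twist models satisfy Skinner–Urban's (irr) + auxiliary-prime hypotheses (`p ≥ 3`), the b2b located gap
  `ChiBranchRatLowerDvd[Odd]At W p` together with `skinner_urban_main_conjecture` (2) for the twist models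
  IMPLIES this lane's descended input `GordTwistBaseChangeLower{Even,Odd}At W p` (Part 2 §6's abstract
  `C_pow_mul_mem_span_of_rational_lower` + principal characteristic ideals + Part 6's boundedness).
  With Part 4 §7 (the converse, modulo Kato (2), Rohrlich, torsion): ON THE S–U ROWS THE TWO TYPED INPUTS
  ARE EQUIVALENT modulo named facts — the twist-field road re-bases the located gap T-N10R over
  `K = ℚ(√p*)`; it does not shrink it (gen 0's verdict, now at predicate level and rationally, hence
  without any image hypothesis beyond S–U's own (irr)).

References: Skinner–Urban, Invent. Math. 195 (2014) Thm. 3.6.4 (p. 43), Cor. 3.6.2 (p. 42)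
[SkinnerUrban2014]; Mazur–Tate–Teitelbaum, Invent. Math. 84 (1986) §I.12–I.13 [MazurTateTeitelbaum1986Invent];
R. Greenberg, LNM 1716 (1999) §1 [GreenbergLNM1716]; Burungale–Castella–Skinner, IMRN 2025 §5 (5.3)
[BurungaleCastellaSkinner2025].
-/

set_option autoImplicit false
set_option linter.dupNamespace false

noncomputable section

open scoped Classical MatrixGroups ModularForm

open CongruenceSubgroup WeierstrassCurve Literature.NumberTheory.EllipticCurves
  Literature.NumberTheory.EllipticCurves.ModularForms
  Literature.NumberTheory.EllipticCurves.Rank1Residual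
  Literature.NumberTheory.GaloisRepresentations

namespace Summit.BirchSwinnertonDyer.BirchSwinnertonDyer.Theorems.AdditiveBranchIMCTwistField

open Summit.BirchSwinnertonDyer.Rank1Residual.Additive

/-! ## §14 Integer exponents -/

section ZPow

variable {p : ℕ} [hp : Fact p.Prime]

/-- **Integer-exponent bookkeeping**: `ι g = p^k·L` with `k ∈ ℤ` gives
`p^{(−k)⁺}·ι g = ι(p^{k⁺})·L`. [folklore] -/
theorem C_pow_mul_map_eq_of_map_eq_C_zpow_mul {g : IwasawaAlgebra p} {L : PowerSeries ℚ_[p]} {k : ℤ}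
    (h : iwasawaToPowerSeries p g = PowerSeries.C ((p : ℚ_[p]) ^ k) * L) :
    PowerSeries.C ((p : ℚ_[p]) ^ (-k).toNat) * iwasawaToPowerSeries p g =
      iwasawaToPowerSeries p (PowerSeries.C ((p : ℤ_[p]) ^ k.toNat)) * L := by
  have hp0 : (p : ℚ_[p]) ≠ 0 := Nat.cast_ne_zero.mpr hp.out.ne_zero
  have hk : k + (((-k).toNat : ℕ) : ℤ) = ((k.toNat : ℕ) : ℤ) := by
    have := Int.toNat_sub_toNat_neg k
    omega
  have hzpow : (p : ℚ_[p]) ^ k * (p : ℚ_[p]) ^ (-k).toNat = (p : ℚ_[p]) ^ k.toNat := by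
    rw [← zpow_natCast (p : ℚ_[p]) (-k).toNat, ← zpow_add₀ hp0, hk, zpow_natCast]
  rw [iwasawaToPowerSeries_C_natCast_pow p, h]
  calc PowerSeries.C ((p : ℚ_[p]) ^ (-k).toNat) * (PowerSeries.C ((p : ℚ_[p]) ^ k) * L)
        = PowerSeries.C ((p : ℚ_[p]) ^ k * (p : ℚ_[p]) ^ (-k).toNat) * L := by
          rw [map_mul]; ring
    _ = PowerSeries.C ((p : ℚ_[p]) ^ k.toNat) * L := by rw [hzpow]

end ZPow

/-! ## §15 (BC-Gord) ⟸ the located gap + Skinner–Urban for the twist models -/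

section Converse

variable {W : WeierstrassCurve ℚ} {p : ℕ} [hp : Fact p.Prime]

/-- **The rational «no free lunch», even, at predicate level.** On the rows whose good ordinary twist
models `V` (`C • V^{(p)} = W`) are residually irreducible at `p` with an auxiliary multiplicative prime
`ℓ ≠ p`, `p ∤ ord_ℓ Δ_V` (Skinner–Urban's (irr) + auxiliary prime, displayed as `hrows`), `p ≥ 3`: the b2b
located gap `ChiBranchRatLowerDvdAt W p` (one-sided RATIONAL Skinner–Urban containment on the even
branch) and Skinner–Urban's theorem for the twist models (`skinner_urban_main_conjecture`, clause (2):
`char X(V/ℚ_∞) = (g)`, `ι g = p^k·L_p(f,α,T)`, `k ∈ ℤ`) IMPLY the descended input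
`GordTwistBaseChangeLowerEvenAt W p` — with `m = (−k)⁺ + m_E + n_E + n_𝓛` (principal characteristic ideals,
Part 2 §6's `C_pow_mul_mem_span_of_rational_lower`, Part 6's boundedness of `𝓛`).
[cite: SkinnerUrban2014, Thm. 3.6.4 (p. 43)] [cite: MazurTateTeitelbaum1986Invent, §I.12–I.13]
[cite: BurungaleCastellaSkinner2025, §5 (5.3) (shape)] -/
theorem gordTwistBaseChangeLowerEvenAt_of_skinnerUrban_of_ratLowerDvd
    (hSU : ∀ (V : WeierstrassCurve ℚ) [V.IsElliptic] [V.IsGloballyMinimal] (κ : ZpExtension ℚ p)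
      (γ : Field.absoluteGaloisGroup ℚ) (N : ℕ) [NeZero N] (f : CuspForm (Gamma0 N) 2),
      skinner_urban_main_conjecture V p (κ := κ) (γ := γ) (f := f))
    (hp3 : 3 ≤ p) (hp1 : p % 4 = 1)
    (hrows : ∀ (V : WeierstrassCurve ℚ) [V.IsElliptic] [V.IsGloballyMinimal],
      (∃ C : VariableChange ℚ, C • V.quadraticTwist (p : ℚ) = W) → GoodOrd V p →
      V.HasIrreducibleModPGaloisRep p ∧
        ∃ ℓ : ℕ, ∃ _ : Fact ℓ.Prime, ℓ ≠ p ∧ V.HasMultiplicativeReductionAtPrime ℓ ∧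
          ¬ p ∣ padicValInt ℓ V.minimalDiscriminantInt)
    (hE : ChiBranchRatLowerDvdAt W p) :
    GordTwistBaseChangeLowerEvenAt W p := by
  intro V _ _ C hV hCW N _ f hf κ γ hκ hγ hγ' DV D ϖ _ _ hϖ
  obtain ⟨hirr, haux⟩ := hrows V ⟨C, hCW⟩ hV
  -- Skinner–Urban (2) for `V`: `char X(V/ℚ_∞) = (x₀)`, `ι x₀ = p^k · L`
  obtain ⟨-, ⟨x₀, k, hcharV, hιx₀⟩, -⟩ := hSU V κ γ N f hp3 hV.1 hV.2 hirr haux hκ hγ hγ' hf DV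
  have h1 := C_pow_mul_map_eq_of_map_eq_C_zpow_mul hιx₀
  -- a generator `y₀` of `char X(W/ℚ_∞)` and the located gap at `y₀`
  haveI : (Literature.NumberTheory.EllipticCurves.Module.charIdeal (IwasawaAlgebra p) D.X).IsPrincipal :=
    charIdeal_isPrincipal_holds p D.X
  obtain ⟨y₀, hy₀⟩ := Submodule.IsPrincipal.principal
    (Literature.NumberTheory.EllipticCurves.Module.charIdeal (IwasawaAlgebra p) D.X)
  have hcharW : D.charIdeal = Ideal.span {y₀} := hy₀
  have hy₀mem : y₀ ∈ D.charIdeal := by rw [hcharW]; exact Ideal.mem_span_singleton_self y₀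
  obtain ⟨GE, mE, nE, hmemE, hGE⟩ := hE V hp1 ⟨C, hCW⟩ hV hκ hγ hγ' hf D ϖ hϖ y₀ hy₀mem
  obtain ⟨b, hb⟩ := Ideal.mem_span_singleton'.mp hmemE
  have h2 : PowerSeries.C ((p : ℚ_[p]) ^ mE) * iwasawaToPowerSeries p y₀ =
      iwasawaToPowerSeries p (b * PowerSeries.C ((p : ℤ_[p]) ^ nE)) *
        (PowerSeries.C ((ϖ : ℚ) : ℚ_[p]) * padicLFunctionBranch f (unitRoot V p : ℚ_[p]) (p / 2)) := by
    have h := congrArg (iwasawaToPowerSeries p) hb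
    rw [map_mul, map_mul, hGE, iwasawaToPowerSeries_C_natCast_pow p] at h
    rw [map_mul, iwasawaToPowerSeries_C_natCast_pow p, ← h]
    ring
  -- boundedness of `𝓛`
  obtain ⟨n, G, hG⟩ := memIwasawaRat_padicLFunction_mul_branch_of_isNewformOf hV hf ϖ (p / 2)
  refine ⟨(-k).toNat + mE + n, n, G, hG.symm, fun x hx y hy ↦ ?_⟩
  have hx' : x ∈ Ideal.span {x₀} := by
    change x ∈ Literature.NumberTheory.EllipticCurves.Module.charIdeal (IwasawaAlgebra p) DV.X at hx
    rwa [show Literature.NumberTheory.EllipticCurves.Module.charIdeal (IwasawaAlgebra p) DV.X =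
      Ideal.span {x₀} from hcharV] at hx
  have hy' : y ∈ Ideal.span {y₀} := by
    change y ∈ Literature.NumberTheory.EllipticCurves.Module.charIdeal (IwasawaAlgebra p) D.X at hy
    rwa [hy₀] at hy
  exact C_pow_mul_mem_span_of_rational_lower h1 h2 hG hx' hy'

/-- **The rational «no free lunch», odd, at predicate level** (`p ≡ 3 (mod 4)`, `p ≥ 3`; minus symbols).
[cite: SkinnerUrban2014, Thm. 3.6.4 (p. 43)] [cite: MazurTateTeitelbaum1986Invent, §I.12–I.13]
[cite: BurungaleCastellaSkinner2025, §5 (5.3) (shape)] -/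
theorem gordTwistBaseChangeLowerOddAt_of_skinnerUrban_of_ratLowerDvdOdd
    (hSU : ∀ (V : WeierstrassCurve ℚ) [V.IsElliptic] [V.IsGloballyMinimal] (κ : ZpExtension ℚ p)
      (γ : Field.absoluteGaloisGroup ℚ) (N : ℕ) [NeZero N] (f : CuspForm (Gamma0 N) 2),
      skinner_urban_main_conjecture V p (κ := κ) (γ := γ) (f := f))
    (hp3 : 3 ≤ p) (hp4 : p % 4 = 3)
    (hrows : ∀ (V : WeierstrassCurve ℚ) [V.IsElliptic] [V.IsGloballyMinimal],
      (∃ C : VariableChange ℚ, C • V.quadraticTwist (-(p : ℚ)) = W) → GoodOrd V p →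
      V.HasIrreducibleModPGaloisRep p ∧
        ∃ ℓ : ℕ, ∃ _ : Fact ℓ.Prime, ℓ ≠ p ∧ V.HasMultiplicativeReductionAtPrime ℓ ∧
          ¬ p ∣ padicValInt ℓ V.minimalDiscriminantInt)
    (hE : ChiBranchRatLowerDvdOddAt W p) :
    GordTwistBaseChangeLowerOddAt W p := by
  intro V _ _ C hV hCW N _ f hf κ γ hκ hγ hγ' DV D ϖ _ _ hϖ
  obtain ⟨hirr, haux⟩ := hrows V ⟨C, hCW⟩ hV
  obtain ⟨-, ⟨x₀, k, hcharV, hιx₀⟩, -⟩ := hSU V κ γ N f hp3 hV.1 hV.2 hirr haux hκ hγ hγ' hf DV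
  have h1 := C_pow_mul_map_eq_of_map_eq_C_zpow_mul hιx₀
  haveI : (Literature.NumberTheory.EllipticCurves.Module.charIdeal (IwasawaAlgebra p) D.X).IsPrincipal :=
    charIdeal_isPrincipal_holds p D.X
  obtain ⟨y₀, hy₀⟩ := Submodule.IsPrincipal.principal
    (Literature.NumberTheory.EllipticCurves.Module.charIdeal (IwasawaAlgebra p) D.X)
  have hcharW : D.charIdeal = Ideal.span {y₀} := hy₀
  have hy₀mem : y₀ ∈ D.charIdeal := by rw [hcharW]; exact Ideal.mem_span_singleton_self y₀
  obtain ⟨GE, mE, nE, hmemE, hGE⟩ := hE V hp4 ⟨C, hCW⟩ hV hκ hγ hγ' hf D ϖ hϖ y₀ hy₀mem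
  obtain ⟨b, hb⟩ := Ideal.mem_span_singleton'.mp hmemE
  have h2 : PowerSeries.C ((p : ℚ_[p]) ^ mE) * iwasawaToPowerSeries p y₀ =
      iwasawaToPowerSeries p (b * PowerSeries.C ((p : ℤ_[p]) ^ nE)) *
        (PowerSeries.C ((ϖ : ℚ) : ℚ_[p]) *
          padicLFunctionMinusBranch f (unitRoot V p : ℚ_[p]) (p / 2)) := by
    have h := congrArg (iwasawaToPowerSeries p) hb
    rw [map_mul, map_mul, hGE, iwasawaToPowerSeries_C_natCast_pow p] at h
    rw [map_mul, iwasawaToPowerSeries_C_natCast_pow p, ← h]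
    ring
  obtain ⟨n, G, hG⟩ := memIwasawaRat_padicLFunction_mul_minusBranch_of_isNewformOf hV hf ϖ (p / 2)
  refine ⟨(-k).toNat + mE + n, n, G, hG.symm, fun x hx y hy ↦ ?_⟩
  have hx' : x ∈ Ideal.span {x₀} := by
    change x ∈ Literature.NumberTheory.EllipticCurves.Module.charIdeal (IwasawaAlgebra p) DV.X at hx
    rwa [show Literature.NumberTheory.EllipticCurves.Module.charIdeal (IwasawaAlgebra p) DV.X =
      Ideal.span {x₀} from hcharV] at hx
  have hy' : y ∈ Ideal.span {y₀} := by
    change y ∈ Literature.NumberTheory.EllipticCurves.Module.charIdeal (IwasawaAlgebra p) D.X at hy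
    rwa [hy₀] at hy
  exact C_pow_mul_mem_span_of_rational_lower h1 h2 hG hx' hy'

end Converse

end Summit.BirchSwinnertonDyer.BirchSwinnertonDyer.Theorems.AdditiveBranchIMCTwistField

end
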